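import Summits.QuantumFields.YangMills.Theorems.BalabanLadderInfVolRPSquare
import Summits.QuantumFields.YangMills.Theorems.BalabanLadderInfVolTranslations
import Summits.QuantumFields.YangMills.Theorems.ConvexGribovBodyContinuumLegGivenGapStubCsclKLevelB
import Summits.QuantumFields.YangMills.Theorems.FradkinShenkerFlowFiniteSusceptibilityWeakCouplingMirrorDominationAxis0
import Summits.QuantumFields.YangMills.Theorems.ContractibleFibreFibreToTorusStubTubeMixingState
import HarnessLib

/-!
# The Osterwalder–Seiler contraction of the reflection-positivity square under time translations, for site-RP
# translation-invariant states on `ℤ⁴` gauge fields (tool for route `OnsetTautology`, support `OnsetContraction`, stmt-QuantumFields-28128)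

Route `route-QuantumFields-OnsetTautology` (ideator ym-idea-11 g6; bears_on R2a-IV leaf
`InfiniteVolumeContinuum.HypercubicOSDataFromInfiniteVolume`; no summit, leaf or NT statement is proved by this file).
Width seat ym-t4-w10 g0 (free hands).  THEOREMS ONLY (0 `def`, 0 `sorry`), filed `--supports stmt-QuantumFields-28128`; the
item itself is `Theorems/OnsetTautologyOnsetContraction.lean`.

WHAT IS PROVED (ns `…Theorems.OnsetContractionOS`):
* §1 `le_initial_of_sq_le_mul_double` — a real sequence with `0 ≤ c 0`, `c t ^ 2 ≤ c 0 · c (2t)` and bounded above satisfies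
  `c t ≤ c 0` (the log-convexity ∕ boundedness mechanism behind `‖e^{-tH}‖ ≤ 1`).
* §2 **`osContraction`** — for every site-reflection-positive, `ℤ⁴`-translation-invariant probability measure `μ` on the gauge
  fields of `ℤ⁴` (`GaugeBoot.IsReflectionPositiveFor (configSiteReflect 0) (siteHalfEdges 0) μ`, which the tree PROVES for every
  torus limit state, `GaugeBoot.siteRP_zero_of_mem_infiniteVolumeLimitPoints`) and every bounded measurable real observable `A`
  of the closed positive half `{x₀ ≥ 0}`: `∫ A(θ_{-t e₀} Θ U)·A(θ_{-t e₀} U) dμ ≤ ∫ A(Θ U)·A(U) dμ` for all `t : ℕ` — reflection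
  positivity of `A + λ·A∘θ_{-t e₀}` gives `c t ^ 2 ≤ c 0 · c (2t)` for the mirror sequence `c t = ∫ A(ΘU) A(θ_{-t e₀} U) dμ`,
  which is bounded; supporting identities `configShift_neg_single_cfgReflect` (`θ_{-t e₀} Θ = Θ θ_{t e₀}`),
  `integral_shift_reflect_mul`, `dependsOn_comp_configShift_neg_single` (tree: `FibreToTorus.configShift_configShift`,
  `ContinuumLegGivenGap.klevel_configShift_zero`, `MirrorDominationAxis0.siteReflect_single_zero` reused by name).

References: K. Osterwalder, E. Seiler, Ann. Phys. 110 (1978) 440, §2 [OsterwalderSeiler1978]; J. Glimm, A. Jaffe,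
Quantum Physics (1987) §6.1; J. Fröhlich, R. Israel, E. Lieb, B. Simon, CMP 62 (1978) 1, Thm. 2.1.
-/

set_option autoImplicit false

noncomputable section

open scoped BigOperators ComplexConjugate ComplexOrder
open MeasureTheory Filter Topology
open Literature.MathematicalPhysics.QuantumFieldTheory Literature.MathematicalPhysics.QuantumLattice
open Literature.Probability.LatticeModels (Site)
open Summit.QuantumFields.GaugeBoot (configSiteReflect siteHalfEdges IsReflectionPositiveFor)
open Summit.QuantumFields.YangMills.Theorems.InfiniteVolume (integral_comp_configShift)
open Summit.QuantumFields.YangMills.Theorems.InfVolRP (configSiteReflect_zero_eq_cfgReflect)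
open Summit.QuantumFields.YangMills.Theorems.FibreToTorus (configShift_configShift)
open Summit.QuantumFields.YangMills.Theorems.ContinuumLegGivenGap (klevel_configShift_zero)

namespace Summit.QuantumFields.YangMills.Theorems.OnsetContractionOS

/-! ## §1 A bounded sequence that is log-convex at doubling is dominated by its initial value -/

/-- If `0 ≤ c 0`, `c t ^ 2 ≤ c 0 * c (2 t)` for every `t`, and `c` is bounded above, then `c t ≤ c 0` for every `t`. -/
theorem le_initial_of_sq_le_mul_double {c : ℕ → ℝ} (h0 : 0 ≤ c 0) (hcs : ∀ t, c t ^ 2 ≤ c 0 * c (2 * t))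
    (hbd : ∃ M, ∀ t, c t ≤ M) (t : ℕ) : c t ≤ c 0 := by
  by_contra hlt
  push Not at hlt
  rcases h0.eq_or_lt with h00 | h0pos
  · -- `c 0 = 0` forces `c t = 0`
    have h := hcs t
    rw [← h00, zero_mul] at h
    have : c t = 0 := by nlinarith
    linarith
  · obtain ⟨M, hM⟩ := hbd
    -- ratios `a k = c (2^k t) / c 0` satisfy `a (k+1) ≥ (a k)^2`, `a 0 > 1`
    set ρ : ℝ := c t / c 0 with hρ
    have hρ1 : 1 < ρ := by rw [hρ, lt_div_iff₀ h0pos, one_mul]; exact hlt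
    have hpow : ∀ k : ℕ, ρ ^ (2 ^ k) ≤ c (2 ^ k * t) / c 0 := by
      intro k
      induction k with
      | zero => simp [hρ]
      | succ k ih =>
        have hk0 : 0 ≤ ρ ^ (2 ^ k) := pow_nonneg (zero_le_one.trans hρ1.le) _
        have h1 : (ρ ^ (2 ^ k)) ^ 2 ≤ (c (2 ^ k * t) / c 0) ^ 2 := pow_le_pow_left₀ hk0 ih 2
        have h2 : (c (2 ^ k * t) / c 0) ^ 2 ≤ c (2 ^ (k + 1) * t) / c 0 := by
          have h := hcs (2 ^ k * t)
          rw [div_pow, div_le_div_iff₀ (pow_pos h0pos 2) h0pos]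
          calc c (2 ^ k * t) ^ 2 * c 0 ≤ (c 0 * c (2 * (2 ^ k * t))) * c 0 :=
                mul_le_mul_of_nonneg_right h h0pos.le
            _ = c (2 ^ (k + 1) * t) * c 0 ^ 2 := by rw [pow_succ]; ring_nf
        calc ρ ^ (2 ^ (k + 1)) = (ρ ^ (2 ^ k)) ^ 2 := by rw [pow_succ, pow_mul]
          _ ≤ _ := h1.trans h2
    obtain ⟨n, hn⟩ := pow_unbounded_of_one_lt (M / c 0) hρ1
    have hle : ρ ^ n ≤ ρ ^ (2 ^ n) := pow_le_pow_right₀ hρ1.le (Nat.lt_two_pow_self).le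
    have hM' : c (2 ^ n * t) / c 0 ≤ M / c 0 := div_le_div_of_nonneg_right (hM _) h0pos.le
    linarith [hpow n]


/-! ## §2 The Osterwalder–Seiler contraction in a site-RP, translation-invariant state on `ℤ⁴` -/

section Core

variable {G : Type} [Group G] [TopologicalSpace G] [IsTopologicalGroup G] [CompactSpace G]
  [MeasurableSpace G] [BorelSpace G]

omit [TopologicalSpace G] [IsTopologicalGroup G] [CompactSpace G] [BorelSpace G] in
/-- **The mirror conjugates an upward time shift into a downward one**:
`θ_{-t e₀} (Θ U) = Θ (θ_{t e₀} U)`. -/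
theorem configShift_neg_single_cfgReflect (z : ℤ) (U : LGConfig 4 G) :
    configShift (-(Pi.single 0 z : Site 4)) (cfgReflect U) = cfgReflect (configShift (Pi.single 0 z) U) := by
  rw [cfgReflect_configShift, FiniteSusceptibilityWeakCoupling.MirrorDominationAxis0.siteReflect_single_zero]

omit [TopologicalSpace G] [IsTopologicalGroup G] [CompactSpace G] [BorelSpace G] in
/-- **Moving a time shift across the mirror inside a translation-invariant expectation**:
`∫ F(θ_{-t e₀} Θ U) · H(U) dμ = ∫ F(Θ U) · H(θ_{-t e₀} U) dμ`. -/
theorem integral_shift_reflect_mul {μ : Measure (LGConfig 4 G)} (hTI : IsZdTranslationInvariant μ)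
    (F H : LGConfig 4 G → ℝ) (z : ℤ) :
    ∫ U, F (configShift (-(Pi.single 0 z : Site 4)) (cfgReflect U)) * H U ∂μ =
      ∫ U, F (cfgReflect U) * H (configShift (-(Pi.single 0 z : Site 4)) U) ∂μ := by
  have h := integral_comp_configShift hTI (Pi.single 0 z)
    (fun V => F (cfgReflect V) * H (configShift (-(Pi.single 0 z : Site 4)) V))
  simp only [configShift_configShift, neg_add_cancel, klevel_configShift_zero] at h
  simp_rw [configShift_neg_single_cfgReflect]
  exact h

omit [Group G] [TopologicalSpace G] [IsTopologicalGroup G] [CompactSpace G] [BorelSpace G] in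
/-- An upward time shift of an observable of the closed positive half stays in the closed positive half. -/
theorem dependsOn_comp_configShift_neg_single {A : LGConfig 4 G → ℝ} (hAd : DependsOn A (siteHalfEdges (d := 4) 0))
    (t : ℕ) : DependsOn (fun U => A (configShift (-(Pi.single 0 (t : ℤ) : Site 4)) U)) (siteHalfEdges (d := 4) 0) := by
  intro U V hUV
  refine hAd fun e he => ?_
  simp only [configShift_apply]
  refine hUV _ ?_
  have he' : (0 : ℤ) ≤ e.1 0 := he
  show (0 : ℤ) ≤ (e.1 - -(Pi.single (0 : Fin 4) (t : ℤ) : Site 4)) (0 : Fin 4)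
  rw [Pi.sub_apply, Pi.neg_apply, Pi.single_eq_same]
  omega

omit [CompactSpace G] in
/-- **Osterwalder–Seiler contraction.**  In a site-reflection-positive, `ℤ⁴`-translation-invariant probability measure on
`ℤ⁴` gauge fields, for every bounded measurable real observable `A` of the closed positive half `{x₀ ≥ 0}` and every
`t : ℕ`: `∫ A(θ_{-t e₀} Θ U) · A(θ_{-t e₀} U) dμ ≤ ∫ A(Θ U) · A(U) dμ` — the RP square does not increase when the
observable is translated AWAY from the mirror (`‖𝒯^t Â‖ ≤ ‖Â‖` on the OS space).  Proof: with
`c n = ∫ A(ΘU) A(θ_{-n e₀}U) dμ`, reflection positivity of `A + λ A∘θ_{-n e₀}` gives `c n ^ 2 ≤ c 0 · c (2n)`, the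
sequence is bounded, hence `c n ≤ c 0` (`le_initial_of_sq_le_mul_double`). -/
theorem osContraction [SecondCountableTopology G] {μ : Measure (LGConfig 4 G)} [IsProbabilityMeasure μ]
    (hRP : IsReflectionPositiveFor (configSiteReflect (G := G) 0) (siteHalfEdges 0) μ)
    (hTI : IsZdTranslationInvariant μ) {A : LGConfig 4 G → ℝ} (hAm : Measurable A)
    (hAb : ∃ C, ∀ U, |A U| ≤ C) (hAd : DependsOn A (siteHalfEdges (d := 4) 0)) (t : ℕ) :
    ∫ U, A (configShift (-(Pi.single 0 (t : ℤ) : Site 4)) (cfgReflect U)) *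
        A (configShift (-(Pi.single 0 (t : ℤ) : Site 4)) U) ∂μ
      ≤ ∫ U, A (cfgReflect U) * A U ∂μ := by
  obtain ⟨C, hC⟩ := hAb
  -- the mirror sequence
  set c : ℕ → ℝ := fun n => ∫ U, A (cfgReflect U) * A (configShift (-(Pi.single 0 (n : ℤ) : Site 4)) U) ∂μ with hc
  -- measurability / boundedness / integrability bookkeeping
  have hΘ : Measurable (cfgReflect (G := G)) := measurable_cfgReflect
  have hmeasT : ∀ n : ℕ, Measurable fun U => A (configShift (-(Pi.single 0 (n : ℤ) : Site 4)) U) := fun n =>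
    hAm.comp (configShift _).measurable
  have hint : ∀ {F H : LGConfig 4 G → ℝ}, Measurable F → Measurable H → (∀ U, |F U| ≤ C) → (∀ U, |H U| ≤ C) →
      Integrable (fun U => F (cfgReflect U) * H U) μ := by
    intro F H hF hH hFb hHb
    refine Integrable.of_bound ((hF.comp hΘ).mul hH).aestronglyMeasurable (C * C) (Eventually.of_forall fun U => ?_)
    rw [Real.norm_eq_abs, abs_mul]
    exact mul_le_mul (hFb (cfgReflect U)) (hHb U) (abs_nonneg _)
      ((abs_nonneg (F (cfgReflect U))).trans (hFb (cfgReflect U)))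
  have hbound : ∀ {F H : LGConfig 4 G → ℝ}, (∀ U, |F U| ≤ C) → (∀ U, |H U| ≤ C) →
      |∫ U, F (cfgReflect U) * H U ∂μ| ≤ C * C := by
    intro F H hFb hHb
    have h := norm_integral_le_of_norm_le_const (μ := μ) (f := fun U => F (cfgReflect U) * H U) (C := C * C)
      (Eventually.of_forall fun U => by
        rw [Real.norm_eq_abs, abs_mul]
        exact mul_le_mul (hFb (cfgReflect U)) (hHb U) (abs_nonneg _)
          ((abs_nonneg (F (cfgReflect U))).trans (hFb (cfgReflect U))))
    rwa [Real.norm_eq_abs, probReal_univ, mul_one] at h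
  -- `c 0` is the RP square, the left-hand side is `c (2t)`
  have hc0 : ∫ U, A (cfgReflect U) * A U ∂μ = c 0 := by
    simp only [hc, Nat.cast_zero, Pi.single_zero, neg_zero, klevel_configShift_zero]
  have hTT : ∀ (n : ℕ) (U : LGConfig 4 G), configShift (-(Pi.single 0 (n : ℤ) : Site 4))
      (configShift (-(Pi.single 0 (n : ℤ) : Site 4)) U) = configShift (-(Pi.single 0 ((2 * n : ℕ) : ℤ) : Site 4)) U := by
    intro n U
    rw [configShift_configShift, ← neg_add, ← Pi.single_add]
    congr 3
    push_cast
    ring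
  have hsq : ∀ n : ℕ, ∫ U, A (configShift (-(Pi.single 0 (n : ℤ) : Site 4)) (cfgReflect U)) *
      A (configShift (-(Pi.single 0 (n : ℤ) : Site 4)) U) ∂μ = c (2 * n) := by
    intro n
    rw [integral_shift_reflect_mul hTI A (fun U => A (configShift (-(Pi.single 0 (n : ℤ) : Site 4)) U)) n]
    simp only [hTT]
    rfl
  have hcross : ∀ n : ℕ, ∫ U, A (configShift (-(Pi.single 0 (n : ℤ) : Site 4)) (cfgReflect U)) * A U ∂μ = c n :=
    fun n => integral_shift_reflect_mul hTI A A n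
  rw [hsq, hc0]
  -- reflection positivity of `A + λ · A∘θ_{-n e₀}` : the quadratic `c 0 + 2 λ c n + λ² c (2n)` is non-negative
  have hquad : ∀ (n : ℕ) (lam : ℝ), 0 ≤ c (2 * n) * (lam * lam) + 2 * c n * lam + c 0 := by
    intro n lam
    set X : LGConfig 4 G → ℝ := fun U => A U + lam * A (configShift (-(Pi.single 0 (n : ℤ) : Site 4)) U) with hX
    have hXm : Measurable X := hAm.add ((hmeasT n).const_mul lam)
    have hXb : ∀ U, |X U| ≤ C + |lam| * C := fun U => by
      refine (abs_add_le _ _).trans (add_le_add (hC _) ?_)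
      rw [abs_mul]; exact mul_le_mul_of_nonneg_left (hC _) (abs_nonneg _)
    have hXd : DependsOn X (siteHalfEdges (d := 4) 0) := by
      intro U V hUV
      have h1 : A U = A V := hAd hUV
      have h2 : A (configShift (-(Pi.single 0 (n : ℤ) : Site 4)) U) = A (configShift (-(Pi.single 0 (n : ℤ) : Site 4)) V) :=
        dependsOn_comp_configShift_neg_single hAd n hUV
      simp only [hX, h1, h2]
    have hpos := hRP (fun U => ((X U : ℝ) : ℂ)) (Complex.measurable_ofReal.comp hXm)
      ⟨C + |lam| * C, fun U => by rw [Complex.norm_real, Real.norm_eq_abs]; exact hXb U⟩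
      (fun U V hUV => by simp only [hXd hUV])
    simp only [configSiteReflect_zero_eq_cfgReflect, Complex.conj_ofReal, ← Complex.ofReal_mul,
      integral_complex_ofReal, Complex.zero_le_real] at hpos
    -- expand the square
    have hXX : ∀ U, X (cfgReflect U) * X U =
        A (cfgReflect U) * A U
          + lam * (A (cfgReflect U) * A (configShift (-(Pi.single 0 (n : ℤ) : Site 4)) U) + A (configShift (-(Pi.single 0 (n : ℤ) : Site 4)) (cfgReflect U)) * A U)
          + lam * lam * (A (configShift (-(Pi.single 0 (n : ℤ) : Site 4)) (cfgReflect U)) * A (configShift (-(Pi.single 0 (n : ℤ) : Site 4)) U)) := fun U => by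
      simp only [hX]; ring
    have h1 : Integrable (fun U => A (cfgReflect U) * A U) μ := hint hAm hAm hC hC
    have h2 : Integrable (fun U => A (cfgReflect U) * A (configShift (-(Pi.single 0 (n : ℤ) : Site 4)) U)) μ :=
      hint hAm (hmeasT n) hC (fun U => hC _)
    have h3 : Integrable (fun U => A (configShift (-(Pi.single 0 (n : ℤ) : Site 4)) (cfgReflect U)) * A U) μ :=
      hint (hmeasT n) hAm (fun U => hC _) hC
    have h4 : Integrable (fun U => A (configShift (-(Pi.single 0 (n : ℤ) : Site 4)) (cfgReflect U)) *
        A (configShift (-(Pi.single 0 (n : ℤ) : Site 4)) U)) μ :=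
      hint (hmeasT n) (hmeasT n) (fun U => hC _) (fun U => hC _)
    have h23 : Integrable (fun U => lam * (A (cfgReflect U) * A (configShift (-(Pi.single 0 (n : ℤ) : Site 4)) U)
          + A (configShift (-(Pi.single 0 (n : ℤ) : Site 4)) (cfgReflect U)) * A U)) μ := (h2.add h3).const_mul lam
    have h123 : Integrable (fun U => A (cfgReflect U) * A U
        + lam * (A (cfgReflect U) * A (configShift (-(Pi.single 0 (n : ℤ) : Site 4)) U)
          + A (configShift (-(Pi.single 0 (n : ℤ) : Site 4)) (cfgReflect U)) * A U)) μ := h1.add h23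
    have h4' : Integrable (fun U => lam * lam * (A (configShift (-(Pi.single 0 (n : ℤ) : Site 4)) (cfgReflect U)) *
        A (configShift (-(Pi.single 0 (n : ℤ) : Site 4)) U))) μ := h4.const_mul _
    have hI : ∫ U, X (cfgReflect U) * X U ∂μ = c (2 * n) * (lam * lam) + 2 * c n * lam + c 0 := by
      simp_rw [hXX]
      rw [integral_add h123 h4', integral_add h1 h23, integral_const_mul, integral_add h2 h3, integral_const_mul,
        hc0, hcross n, hsq n]
      have : ∫ U, A (cfgReflect U) * A (configShift (-(Pi.single 0 (n : ℤ) : Site 4)) U) ∂μ = c n := rfl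
      rw [this]
      ring
    rw [hI] at hpos
    exact hpos
  have hc0nn : 0 ≤ c 0 := by simpa using hquad 0 0
  have hcs : ∀ n, c n ^ 2 ≤ c 0 * c (2 * n) := fun n => by
    have h := discrim_le_zero (hquad n)
    rw [discrim] at h
    nlinarith [h]
  have hbd : ∃ M, ∀ n, c n ≤ M := ⟨C * C, fun n => (le_abs_self _).trans (hbound hC fun U => hC _)⟩
  exact le_initial_of_sq_le_mul_double hc0nn hcs hbd (2 * t)

end Core

end Summit.QuantumFields.YangMills.Theorems.OnsetContractionOS

end
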